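import Mathlib
import HarnessLib
import HarnessLib.Audit
import Summits.ValiantsHypothesis.Statement
import Literature.Computability.AlgebraicComplexity.DeterminantalComplexity
import Literature.Computability.AlgebraicComplexity.EquivariantDC
import HarnessLib.Audit.Status.Attr

/-!
Route: RigidityForcesSymmetry

# Route RigidityForcesSymmetry — rigidity ⇒ torus symmetry ⇒ Grenet — a minimal determinantal
representation that is locally rigid INSIDE ITS RANK-PROFILE STRATUM forces dc(per_n) = 2^n − 1

X (GRENET INFINITELY OFTEN): for every n₀ there is n ≥ n₀ with dc(per_n) ≥ 2^n − 1, hence dc(per_n)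
= 2^n − 1 by Grenet's
upper bound (tree theorem `determinantalComplexity_perPoly_le_holds`); the expected truth is every n
≥ 3. It suffices because
2^n − 1 infinitely often is not quasi-polynomially bounded, so per ∉ VP (VP ⇒ qp-bounded dc, proved
in tree) and VP ≠ VNP.
REV 2 (route-repair 2026-08-17). The rev-1 crux RigidMinimalRepr (stmt-4163: some minimal
representation has a locally open
GL_m×GL_m-orbit in ALL of R_m(per_n) = {affine Ã : det Ã = per_n}) and its n = 3 probe RigidAtThree
(stmt-4165) are REFUTED in
the tree (`not_RigidMinimalRepr`, `not_RigidAtThree`): locally open ⇒ two-sided-torus-equivariant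
(RigidityForcesTorus, proved) ⇒
size ≥ 2^n − 1 (TorusBound, proved) ⇒ tight ⇒ graded monomial normal form ⇒ the affine unimodular
Koszul ROW TWIST
(1 + t·e_w3(α x_u1 e_w2ᵀ + β x_u2 e_w1ᵀ))·Ã keeps det = per_n, stays affine, tends to Ã and leaves
the orbit — because the RANK of
the x_u1-coefficient matrix JUMPS (`stub_rankJump`). Both decls stay in the file as settled negative
edges. X is now reached as
RankRigidMinimalRepr (some minimal representation (Λ, A) has its constant-gauge orbit open among the
nearby representations whose
coefficient matrices have no larger ranks, rank A′_v ≤ rank A_v for every variable v — the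
rank-profile stratum, a GL_m×GL_m- and
torus-stable locally closed piece of R_m(per_n) that the refuting twist provably leaves; infinitely
often) → RankRigidityForcesTorus
(the torus path keeps every coefficient rank, so the same connectedness argument gives exact
two-sided-torus lifts) → TorusBound.
Lean: `∀ n₀ : ℕ, ∃ n ≥ n₀, 2 ^ n - 1 ≤
Literature.Computability.AlgebraicComplexity.determinantalComplexity
(Literature.Computability.AlgebraicComplexity.perPoly (Fin n) ℂ)`

## Assembly
Deciding theorem `closes (h₁ : RankRigidMinimalRepr) (h₂ : RankRigidityForcesTorus) (h₃ :
TorusBound) (h₄ : GrenetBoundToVH) :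
ValiantsHypothesis` (pure logic, sorry-free, axioms propext/choice/Quot.sound; planner Sketch.lean
rc 0): given n₀, h₁ at max(n₀,3)
yields n ≥ n₀, n ≥ 3 and a minimal (Λ, A) whose orbit is open in its rank stratum; h₂ (stated with
literally the same
sub-expressions) makes Λ + Σ x_v A_v two-sided-torus-equivariant with exact lifts; h₃ gives 2^n − 1
≤ m = dc(per_n), i.e.
GrenetLowerBound at n₀; h₄ (VP ⇒ qp-bounded dc, per ∈ VNP, hub — proved in tree) gives VP ≠ VNP.
TorusBound (stmt-4164) and
GrenetBoundToVH (stmt-4167) are PROVED; RankRigidityForcesTorus is provable now (the landed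
`rigidityForcesTorus_proof` plus rank
invariance of the torus path); the one open item is RankRigidMinimalRepr. The rev-1 items
RigidMinimalRepr, RigidAtThree (refuted),
RigidityForcesTorus and Assembly (proved, rev-1 chain) are kept as records and are no longer
hypotheses of `closes`.

Rationale: WHY THIS LINE. The only exponential lower bounds for dc(per_n) assume symmetry —
LandsbergRessayre2017 (arXiv:1508.05788): C(2n,n) − 1 under all
of G_per (Thm 2.1) and 2^n − 1 under the left normaliser N(T^E) = torus ⋊ S_n (Thm 2.8, PROVED in
tree as
`lr_left_equivariant_lower_holds`) — and LR17 Question 2.2 / Cor 2.3 ask for symmetrisation at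
polynomial cost with "no opinion" and
no mechanism. This line supplies a mechanism from transformation groups / deformation theory: the
gauge group G = GL_m × GL_m and
the source torus T = two-sided diagonal scalings x ↦ D₁xD₂ (the identity component of G_per) act on
R_m(per_n) = {Ã affine :
det Ã = per_n} and commute; both preserve the RANK PROFILE v ↦ rank A_v of the coefficient matrices,
so they act on every rank-profile
stratum S(Ã) = {Ã′ ∈ R_m(per_n) : rank A′_v ≤ rank A_v ∀v} (locally = the level set, by
semicontinuity). If the G-orbit of a
MINIMAL Ã is open in S(Ã) near Ã, the connected torus cannot move the orbit: Ã respects T with exact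
lifts for free (elementary
open-subgroup argument along exp, verbatim the landed `rigidityForcesTorus_proof`), and then the
PROVED torus-only covering bound
TorusBound (regularity → one generic lifted torus element → eigenspace grading → (S,T)-graded ABP →
≥ C(n,j) vertices per level) gives
m ≥ 2^n − 1 — Grenet2011 on the nose, no Weyl group. REV-2 LESSON (refutations
`not_RigidMinimalRepr`, `not_RigidAtThree`, same
Koszul pair as GrenetRigidity's `OptimalUnique(Three)_refuted` and UlrichPadded's
`NoTightInfinity_refuted`): in the FULL variety
R_m(per_n) no minimal representation of per_n (n ≥ 3) has an open constant-gauge orbit, because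
affineness-preserving polynomial
(unimodular) gauge moves exist at every tight graded representation; but every such move that has
been exhibited RAISES a
coefficient rank (`stub_rankJump`; hand check in this unit: a Koszul/syzygy row twist at Grenet(n)
with target row w and support a
(k+1)-set R adds an x_{k,l′} entry, l′ ∈ R ∖ w, in a zero row AND a zero column of coeff(x_{k,l′}) —
level mismatch — so its rank
goes up; level-1 variables have rank-ONE coefficient matrices in every tight graded rep), i.e. it
LEAVES the rank stratum. The
stratum is exactly the ambient locus the three refuters named as the repair ("rank-minimality"), and
at n = 3 it passes the
first-order test: at Grenet(3) the Zariski tangent of R_7(per_3) has dim 141, the S(GL_7²)-orbit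
tangent 96, and the
rank-profile-constrained tangent EXACTLY 96 (sibling route RigidMinimalReps, kit runs
grenet3_tangent{,2,3}.py; lead logs
tangent_grenet3/4.log on stmt-4163: n = 4 unconstrained 652 vs 448). Relation to the two open
siblings (same family "symmetry from
orbit structure", shared PROVED engine TorusBound ≡ RigidMinimalReps.TorusBound):
RigidMinimalReps.DoublyMinimalFinite (stmt-5113)
asks GLOBAL finiteness of G-orbits on the doubly-minimal locus (min size, then min Σ_v rank A_v) for
ALL large n and IMPLIES
RankRigidMinimalRepr (finitely many constructible orbits cover the locus ⇒ one is open in it ⇒ open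
in its rank stratum); FreeSubtorus
reads stabilisers of CLOSED torus orbits in the GIT quotient R_m//S(G) (a different object, subtorus
symmetry, bound up to 2^rank).
This route keeps the WEAKEST rigidity hypothesis of the family: LOCAL, ONE orbit, ONE point,
infinitely often, certifiable at each
fixed n by a finite Zariski-tangent computation plus the landed slice lemmas. Honest content: with
the proved supports the crux is
a DICHOTOMY — for each n ≥ 3 either dc(per_n) = 2^n − 1 or EVERY minimal representation of per_n is
non-isolated modulo constant
gauge inside its own rank stratum (positive-dimensional equal-rank moduli); the lemma "Grenet(n) is
rank-rigid for all n" is PROVED: A1 `GrenetFirstOrderRankRigid` (stmt-21029: Grenet's pencil is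
rank-INFINITESIMALLY rigid for every n ≥ 3; `GrenetGauge.GrenetFirstOrderRankRigid_proof`, p590927,
2026-08-28T00:49Z) and A2 `RankInfRigidToLocallyOpen` (stmt-24282, the rank-constrained slice lemma;
`RankSlice.RankInfRigidToLocallyOpen_proof`, p594361, 2026-08-28T01:40:09Z) are tree theorems, so
`Census.tightRankRigid_of_inf` gives TightRankRigid and `crux_iff_target : RankRigidMinimalRepr ↔
GrenetLowerBound` (Cruxes/RankRigidMinimalRepr/CruxCalibration.lean) holds UNCONDITIONALLY
(`Summit.ValiantsHypothesis.ValiantsHypothesis.Theorems.RigidityForcesSymmetry.RankSlice.rankRigidMinimalRepr_iff_grenetLowerBound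
: RankRigidMinimalRepr ↔ GrenetLowerBound` with NO hypotheses, and `RankSlice.tightRankRigid`,
p594621 Theorems/RigidityForcesSymmetryRankRigidMinimalReprCalibration.lean @6b64e3ae65da,
2026-08-28T01:43Z, val-width-21029-p3 g4). STATE (tenure g11): the route is CALIBRATED — its one
open hypothesis RankRigidMinimalRepr IS Grenet-infinitely-often, a FRONTIER statement that DOMINATES
the summit (GrenetLowerBound ⟹ VH by the proved GrenetBoundToVH, not conversely); the route is a
completed reformulation that exposes the obstruction as a deformation-theoretic object not a
shortcut to VH. DISPOSITION (director-valiant g10 RULING D11.2, 2026-08-28T01:45:52Z + 02:19:23Z):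
the crux 18034 ≡ target 4162 is ONE open content = Grenet optimality i.o., a NAMED OPEN PROBLEM ≥ VH
via this very route ⇒ LAW-GRADE, 0 provers, HELD (hold since 02:23:18Z); the «Grenet(4)
rank-constrained tangent» instrument is DISCHARGED by `RankSlice.tightRankRigid` (all n ≥ 3),
nothing of it remains. What the route still OWNS below the summit is the VH-short FRONTIER LADDER of
the crux's line PairTiedTorusBound — TiedTorusBound k = Grenet's 2^m − 1 for representations
equivariant under the two-sided torus with the first k+1 column scalars tied, reduced rung by rung
to the FINITE tensor statements LaplaceOptimal (k+1) («Laplace expansion is optimal for the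
permutation pattern», `grenetBound_of_laplaceOptimal`): k = 0 is the proved floor TorusBound, k = 1,
2 landed (…TiedTorusBoundOneTwo), and the n = 4 FRONTIER RUNG is LANDED BY NAME —
`laplaceOptimal_four : LaplaceOptimal 4` and `tiedTorusBound_three : TiedTorusBound 3` (p597028
Theorems/RigidityForcesSymmetryRankRigidMinimalReprLaplaceFourOptimal.lean, val-lit p8 g9, 19
maximal cheap profiles of P₄ refuted over 27 helper files). The NEXT rungs are filed as support
items (rank 9, FRONTIER ledger, 0 width until a seat asks): LaplaceOptimalFive (stmt-24813, ≝
`LaplaceOptimal 5`) and TiedTorusBoundFour (stmt-24814, ≝ `TiedTorusBound 4`), with the transfer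
LaplaceOptimalFive → TiedTorusBoundFour PROVED in the tenure sketch (rfs/Sketch_rungs.lean, rc 0:
`grenetBound_of_laplaceOptimal (k := 4)` + `tiedTorusBound_three` + closure_mono). No rank measure,
no natural property, no GCT multiplicity enters.

RANKED CRUXES. #0 GrenetLowerBound (target) — Grenet's bound is attained infinitely often: ∀ n₀ ∃ n
≥ n₀, 2^n − 1 ≤ dc(per_n); expected for every n ≥ 3. (why it might fail: far stronger than VH: any
O(c^n), c < 2, construction for all large n kills it (Ryser/Glynn are a factor n away); beyond
dc(per_3) = 7 (PROVED in tree, `alperBogartVelasco2017_cor_1_4_holds`) nothing is known; dc(per_4) ≤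
14 would be the first alarm.) [Grenet2011, AlperBogartVelasco2017, LandsbergRessayre2017,
MignonRessayre2004]
#2 RankRigidMinimalRepr (crux, NEW rev 2 = C′ of the refuted RigidMinimalRepr; LAW-GRADE · HELD
since 2026-08-28T02:23:18Z per D11.2 — ≡ #0 in kernel) — for infinitely many n there is an affine
determinantal representation Ã = Λ + Σ_v x_v A_v of per_n of MINIMAL size m = dc(per_n) and a
neighbourhood U of (Λ, A) in coefficient space such that every p = (Λ′, A′) ∈ U with det p̃ = per_n
and rank A′_v ≤ rank A_v for all v lies in {(gΛh⁻¹, (gA_vh⁻¹)_v)} (rank Λ′ = m − 1 is automatic by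
von zur Gathen, proved in tree). [difficulty: open-problem] (why it might fail: it is FALSE as soon
as dc(per_n) < 2^n − 1 for all large n (TorusBound + RankRigidityForcesTorus, both proved);
conversely at m = 2^n − 1 Grenet(n) IS rank-rigid to first order for every n ≥ 3 (A1 = stmt-21029
PROVED), and the slice lemma A2 (stmt-24282) is PROVED, so Grenet(n) is rank-rigid (locally, modulo
constant gauge, inside its rank stratum) for every n ≥ 3 and the crux is EXACTLY as hard as
GrenetLowerBound (kernel: `RankSlice.rankRigidMinimalRepr_iff_grenetLowerBound`, p594621) — no
independent failure mode is left.) [LandsbergRessayre2017, HuttenhainIkenmeyer2016,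
AlperBogartVelasco2017, IkenmeyerLandsberg2017, arXiv:2003.04834]
#3 TorusBound (crux, PROVED: `BorderApolarityToricWitnessObstructionQP.stub_torusBound`, also
`RigidMinimalRepsTorusBound.torusBound_proof`) — for n ≥ 3 every two-sided-torus-equivariant (exact
lifts) affine determinantal representation of per_n has size ≥ 2^n − 1. [LandsbergRessayre2017,
Vonzurgathen1987, Grenet2011]
#9 RankRigidityForcesTorus (support, NEW rev 2, provable-now) — the hypothesis of
RankRigidMinimalRepr at (Λ, A) (n ≥ 3, det = per_n, orbit open in the rank stratum near (Λ, A)) ⇒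
`IsEquivariantDetRepr` for the closure of {diag(d_k e_l)}: the proof of `rigidityForcesTorus_proof`
verbatim — its coefficient path F(a,b) = (D Λ, v ↦ e^{a_k+b_l}·D A_v), D = diag(τ,1,…,1), has det =
per_n AND rank(e^{·} D A_v) = rank A_v (D invertible, scalar ≠ 0:
`Matrix.rank_mul_eq_right_of_isUnit_det`, `Matrix.rank_smul`-type lemma), so the constrained
rigidity applies along it; liftable parameters form an additive subgroup of ℂ^2n containing a ball;
closure induction. [LandsbergRessayre2017, Borel1991]
#9 GrenetFirstOrderRankRigid (support = sub-crux A1 `TightRankInfRigid`, filed g1 as TABLE T2 rung,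
PROVED 2026-08-28T00:49Z p590927
`Summit.ValiantsHypothesis.Theorems.RigidityForcesSymmetry.GrenetGauge.GrenetFirstOrderRankRigid_proof`,
line Cruxes/GrenetFirstOrderRankRigid/Lines/grenet_gauge.lean: fix Grenet's witness, split the
Jacobi tangency identity by degree, corank-one constant gauge, torus-weight blocks solved by
induction on the layer) — for every n ≥ 3 Grenet's size-(2^n − 1) pencil is rank-infinitesimally
rigid: every det-tangent, rank-tangent first-order direction is a gauge direction. [Grenet2011,
LandsbergRessayre2017]
#9 RankInfRigidToLocallyOpen (support = sub-crux A2, stmt-24282, PROVED 2026-08-28T01:40:09Z by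
`Summit.ValiantsHypothesis.ValiantsHypothesis.Theorems.RigidityForcesSymmetry.RankSlice.RankInfRigidToLocallyOpen_proof`,
closing file p594361 Theorems/RigidityForcesSymmetryRankInfRigidToLocallyOpen.lean,
val-width-21029-p3 g4 — a DIRECT proof keeping the flat slice engine (`stub_sliceOpen` / the
`stub_pencilLocInj` pattern) and encoding the rank constraint by the Schur-type map F_v(w) =
Y_v·w_v·(1 + A_v⁺w_v)⁻¹·K_v with a {1}-inverse A_v⁺ from transvection diagonalisation, K_v = 1 −
A_v⁺A_v, Y_v = 1 − A_vA_v⁺: rank(A_v + w_v) ≤ rank A_v ∧ det(1 + A_v⁺w_v) ≠ 0 ⇒ F_v(w) = 0, and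
dF_v(0) = (w′ ↦ Y_v w′_v K_v) by `hasFDerivAt_bilinear_of_apply_eq_zero` (linear-vanishing ×
continuous — no derivative of the matrix inverse), kernel = rank-tangent directions; helpers p593139
RankChart, p593725 LocInj; the operator-registered draft line rank_slice (Lines/rank_slice.lean
@c72f36d83f91, stubs stub_rankSliceCover / stub_rankLocInj) is MOOT, record only) — the
RANK-CONSTRAINED SLICE LEMMA: for any pencil x₀ = (Λ, A) with det x̃₀ = f ≠ 0, rank-infinitesimal
rigidity ⇒ near x₀ every pencil with det = f and rank A′_v ≤ rank A_v is gauge-equivalent to x₀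
(unconstrained version: tree theorem `stub_infRigidToLocallyOpen`). With A1 it gives TightRankRigid
and `crux_iff_target : RankRigidMinimalRepr ↔ GrenetLowerBound` (given the proved
RankRigidityForcesTorus) — `RankSlice.rankRigidMinimalRepr_iff_grenetLowerBound`, p594621.
[LandsbergRessayre2017, Fuhrmann–Helmke 2015 §8.5]
#9 LaplaceOptimalFive (support · FRONTIER RUNG, stmt-24813, tenure g11 per D11.2; label CONTESTED
since 2026-08-28T09:55Z (director-valiant g13 R203 (e)); PROGRAMME RE-BASED by R203 (d) after the
REFUTATION of the LO(4,5) hypothesis (RECORDS below): a = 3 DONE by the probe base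
(LaplaceFiveCertified2 files); the (A′) sub-programme «a ≤ 2 structure theorem under LO(4,5)»
(R176/R183 (a)) is DEAD AS TYPED — every `LaplaceOptimalFourFive → …` consumer (`contract_five_rect`
p621105, `no_idle_slot_of_rect`, the planned conditional `…TwoSlicesStructure`) is vacuous and no
further `h45` consumer is filed; KEPT, unconditional and cited by name henceforth: the
rectangular-contraction transfer p620630 `…LaplaceContractRect` (hypothesis-PARAMETRIC in the
rectangular bound, so it becomes informative again with the TRUE (4,5) constant), the normal form
p620674 `two_slices_normalize`, the 21 core instances p620804, the engine certificates,
`laplaceOptimal_four` p597028; DECISION HUNT on 24813 itself led by val-lit-p8 (structure mining of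
the (5,2,2)/(5,3,1)/(6,2,1) profiles; LIFT TEST: does a P₄,₅ identity lift to a split decomposition
of P₅ of weighted count < 120?; companion question «what IS the optimum of the 4-slot × 5-letter
weighted pair count?» — p8's second identity identity8.json (18·P₄,₅ = Σ of EIGHT pair terms,
profile 5×{01|23} + 2×{02|13} + 1×{03|12}, independently confirmed by val-neg-2 g0 625/625) already
gives ≤ 8, so «bound 9» is dead too and the true constant w* ≤ 8 is open from below (LP/rank
certificate over ℚ); 24813-w1 and p3 owe one memo line each on what their landed files prove with NO
LO(4,5) hypothesis / the weakest rectangular hypothesis they consume; a repaired hypothesis C′ =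
«LO(4,5) with the TRUE bound w*» is filed by tenure as a NEW item ONLY once w* is certified optimal,
w1 confirms the transfer still kills enough a = 2 types with w*, and the refuters have passed it at
the smallest weights with rational normalisations — not before (R203 (d))) — Laplace expansion is
optimal for the 5 × 5 permutation pattern: every split-rank-one decomposition of [v injective] on
Fin 5 → Fin 5 has Σ_t |S_t|!(5 − |S_t|)! ≥ 120; ≝ `LaplaceOptimal 5` (Iff.rfl). STATE (a = number of
slice terms): a = 3 certified; a = 2: 158 types alive after the three kernel engines (p8
`a2_alive.json`) — the former conditional kill of 153 of them under LO(4,5) (weights 1/2/10, bound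
10) is VOID as typed; what survives of it under the true bound 9 is p8's/w1's question of the hour;
a = 1: 606 types, a = 0: 111 idle-slot + 428 non-idle types — per-type certificates ((A) of R176)
remain the unconditional route; normal form `two_slices_normalize` (p620674). [difficulty: M–L: d =
4 took 19 profile refutations / 27 files; prior lowered by the (4,5) identity] (why it might fail:
the finite statements must get hard as d grows — all d would give Grenet-optimality for
row-torus-equivariant representations, open; a cheap non-Laplace decomposition of P₅ below 120 is
NOT excluded and is now actively hunted (lift test), the (4,5) pattern having one of weighted count
9 < 10.) [LandsbergRessayre2017, Grenet2011, p597028]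
#9 TiedTorusBoundFour (support · FRONTIER RUNG, stmt-24814, NEW tenure g11, 0 width) — Grenet's 2^m
− 1 ≤ n for every affine determinantal representation of per_m (m ≥ 3) equivariant under the
two-sided torus with e_0 = … = e_4 tied; ≝ `TiedTorusBound 4` (Iff.rfl); ⇐ LaplaceOptimalFive
(transfer PROVED in the tenure sketch) — closes with it by a 10-line file, or directly. (why it
might fail: as 24813, or a 5-tied-equivariant representation below 2^m − 1, which nothing known
constructs.) [LandsbergRessayre2017, Grenet2011, p597028]
#9 GrenetBoundToVH (support, PROVED `GrenetBoundToVH_proof`) — GrenetLowerBound → ValiantsHypothesis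
via VP ⇒ qp-bounded dc (`isQPBounded_determinantalComplexity_of_isVPFamily_holds`), per ∈ VNP, hub.
[BurgisserClausenShokrollahi1997, Burgisser2000, Valiant1979]
RECORDS (rev 1, not hypotheses of `closes`): RigidMinimalRepr (stmt-4163, REFUTED
`not_RigidMinimalRepr`), RigidAtThree (stmt-4165, REFUTED `not_RigidAtThree`), RigidityForcesTorus
(stmt-4166, PROVED, unconstrained version — vacuous at minimal size, true), Assembly (stmt-4168,
PROVED, rev-1 chain). They are kept because landed theorems name them. LaplaceOptimalFourFive
«LO(4,5)» (stmt-27319, support hypothesis of the (A′) sub-programme filed by tenure g12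
2026-08-28T09:45Z per R183 (a), never a binder of `closes`; REFUTED 2026-08-28T10:15:56Z by
`Summit.ValiantsHypothesis.ValiantsHypothesis.Theorems.not_LaplaceOptimalFourFive` (val-lit-p8 g12
p624350; class substantive; DROPPED from the active items with this revision, director g13 R203 (c),
as 4163/4165 were at rev 3): the explicit integer identity Σ_{t=1..9} U_t(v|_{S_t})·W_t(v|_{S_tᶜ}) =
9·[v injective] on all 625 points of [5]^4 with nine PAIR terms (|S_t| = 2: four on {0,1}|{2,3},
four on {0,2}|{1,3}, one on {0,3}|{1,2} = (1 − 3[v₀ = v₃])(1 − 3[v₁ = v₂])), so with u_t = U_t/9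
over ℂ the weighted count is 9·1 = 9 < 10 (artifact
HOME(val-lit)/lmr/p8g12-LO45-refutation/identity.json 23ef3e25ee62…, kit C2 j305078 sparse least
squares on profile (4,4,1) + exact rank factorisation over ℚ; independent recomputation val-neg-2
g0). NEGATIVE KNOWLEDGE: every LO-shaped weighted pair bound for the (4,5) injective pattern is ≤ 8
(identity8.json: eight pair terms, 18·P₄,₅; the nine-term weight-9 identity is the one in the kernel
theorem); the 2-slot contraction Q_{ψ,φ} is not a torus translate of the 5 × 5 pencil (the caveat of
record was the leak); the val-neg-1/ -2 audits' NO-KILL scope (small letters, no 1/9 normalisation)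
missed it — recorded in their addendum on 27319/24813.

TWO-LAYER PLAN. The foreseen glued split of the one open crux is REALISED AS SUPPORTS, not as a
formal `--split` (the crux keeps its own registered frontier line PairTiedTorusBound and stays
claimable): RankRigidMinimalRepr ⇐ TightRankRigid ⇐ A1 `GrenetFirstOrderRankRigid` (stmt-21029,
PROVED) ∧ A2 `RankInfRigidToLocallyOpen` (stmt-24282, PROVED) via `Census.tightRankRigid_of_inf`,
and TightRankRigid → RankRigidityForcesTorus → (RankRigidMinimalRepr ↔ GrenetLowerBound)
(`crux_iff_target`; tenure sketch `crux_iff_target_of_A2`, lean rc 0). A2 has landed: the open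
content of the route IS exactly ONE statement, GrenetLowerBound ≡ RankRigidMinimalRepr (tier (c),
FRONTIER), attacked through the crux's line PairTiedTorusBound (stubs stub_levelDecomp p563411 /
stub_levelBound p540345 landed). Staffing: none owed (A2 done; crux HELD law-grade); the FRONTIER
ladder only — LaplaceOptimalFive / TiedTorusBoundFour (24813/24814) with the booked hands of record
(24813-w1 LEAD a ≤ 2, p3 structure side, p8 numerics; a = 3 done) — the LO(4,5) hypothesis item
LaplaceOptimalFourFive (27319) was REFUTED 2026-08-28 and is dropped (RECORDS); the a ≤ 2 side is
re-based on the decision hunt (R203 (d)). TorusBound needs no split (proved).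

KILL CRITERIA. A continuous family t ↦ Ã_t of pairwise GL_m×GL_m-inequivalent affine representations
of per_n WITH THE RANK PROFILE OF Ã₀ through
EVERY tight two-sided-torus-graded representation Ã₀ of per_n, for all n ≥ n₁ (e.g. a
rank-preserving variant of the Koszul twist,
or an equal-rank syzygy move of higher format), refutes RankRigidMinimalRepr exactly as rev 1 died
(minimal + rank-rigid ⇒ torus ⇒
tight ⇒ family): close `refuted:RankRigidMinimalRepr` — no third local notion is left on this route
(rigidity modulo the full
affine gauge GL_m(ℂ[x])² and GIT-closed orbits are UlrichPadded.OrbitCorankTwo / FreeSubtorus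
territory; global finiteness is
RigidMinimalReps). dc(per_n) < 2^n − 1 for all large n (any O(c^n), c < 2, construction) kills the
crux through the proved supports
(VH untouched). TorusBound is proved, so the former kill branch on it is void. GrenetLowerBound or
DetQP.DetqpThesis proved by other
means moots rank 2. RigidMinimalReps.DoublyMinimalFinite proved ⇒ rank 2 follows (this route then
closes superseded, X reached).

NOT DECOMPOSED YET. Nothing further: A1/A2 are typed supports (above); the constrained tangent
computation at fixed n is SUPERSEDED by A1's proof for all n ≥ 3 (the kit certificate j025573, n =
3..8, constrained tangent = balanced gauge dim 2m² − 2, preceded it). The n = 3 instance of the crux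
(Grenet(3) rank-rigid at the minimal size 7 = dc(per_3)) is a corollary of tree theorems
(`RankSlice.tightRankRigid` for every n ≥ 3 — which also DISCHARGES the director's earlier n = 3
helper ask `rankRigidMinimalRepr_grenet_three`, MOOT per D11.2 — and dc(per_3) = 7) and is
deliberately NOT an item (out of cone, BC6). The tied-torus ladder beyond k = 4 (LaplaceOptimal d, d
≥ 6; the all-k statement = Grenet-optimality for row-torus-equivariant representations, open) is NOT
filed: one rung pair at a time (24813/24814), next pair only after LaplaceOptimalFive closes; the
LO(4,5) hypothesis item LaplaceOptimalFourFive (R183 (a)) lived 09:45–10:15Z 2026-08-28 and was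
refuted by an explicit weight-9 identity (RECORDS) — a repaired bound-9 version `LaplaceFourFiveW`
is filed ONLY under the three conditions of R203 (d) sharpened by identity8 (true constant w* ≤ 8
certified optimal, still kills enough a = 2 types, consumed by w1), and no other hypothesis item is
filed on this ladder without a refuter pass at the smallest weights INCLUDING rational
normalisations first. No S_n, no small-index subgroups, no Laplace bootstrap, no GIT. No definition
items: the two-sided torus, the coefficient model (Λ, A) ↦ Λ.map C + Σ_v X_v • (A v).map C and
`Matrix.rank` are inlined / Mathlib.

CHEAPEST FALSIFIER. The former one (rank-constrained Zariski tangent at Grenet(4), Grenet(5)) is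
SETTLED POSITIVELY for all n (A1 proved; = 2m² − 2 certified n = 3..8 before the proof). What can
still kill the route is only what kills GrenetLowerBound: (i) dc(per_4) ≤ 14 — a size-14 affine
representation of per_4 (binary / small-support search in the style of HuttenhainIkenmeyer2016's 7×7
enumeration; one kit job per support class) would be the first alarm and refutes `∀ n ≥ 3` forms
outright (the crux/target only ask 'infinitely often'); (ii) any uniform O(c^n), c < 2,
determinantal construction for per_n (Ryser/Glynn-type formulas are a factor n away: size ~ n·2^n as
ABPs) kills crux and target together through the proved supports, VH untouched. (A2 is proved; its
toy falsifier is void.)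

NUMBERS. dc(per_3) = 7 (AlperBogartVelasco2017, PROVED in tree), 9 ≤ dc(per_4) ≤ 15; n²/2 ≤
dc(per_n) ≤ 2^n − 1 (MignonRessayre2004; Grenet2011,
tree theorems); edc under all of G_per = C(2n,n) − 1 (LR17 Thm 2.1), under N(T^E) ≥ 2^n − 1 (LR17
Thm 2.8, proved in tree), under the
two-sided torus alone ≥ 2^n − 1 (TorusBound, proved in tree 2026-08-16/17); rank Λ = m − 1 for every
representation of per_n, n ≥ 3
(Vonzurgathen1987 Thm 3.1, proved in tree); Grenet(3): dim T_Z = 141, orbit tangent 96 (97 with the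
det-scaling direction),
rank-constrained tangent 96, 463 binary 7×7 solutions in one class (HuttenhainIkenmeyer2016 Prop 9);
Grenet(4): dim T_Z = 652, orbit
tangent 448, constrained = balanced gauge (A1; kit j025573 n = 3..8: constrained tangent dim = 2m² −
2); the refuting twist raises Σ_v rank A_v by ≥ 1 (`stub_rankJump`). Items after g11: 11 decls (1
target, 2 live cruxes of which 1 proved (TorusBound), 4 live supports ALL proved
(RankRigidityForcesTorus, GrenetBoundToVH, GrenetFirstOrderRankRigid p590927,
RankInfRigidToLocallyOpen p594361), 4 rev-1 records: 2 refuted, 2 proved); hypotheses of `closes`: 4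
(RankRigidMinimalRepr, RankRigidityForcesTorus, TorusBound, GrenetBoundToVH), of which only
RankRigidMinimalRepr is open — and it is ≡ GrenetLowerBound in kernel.

DEFINITION REQUESTS. None. `IsEquivariantDetRepr`, `determinantalComplexity`, `perPoly`,
`Matrix.rank` exist; (record) provers of rank 9 reused
Theorems/RigidityForcesSymmetryRigidityForcesTorus.lean (rft_* pencil lemmas, `rft_lift_of_gauge`)
and, for A2 (stmt-24282, proved),
Theorems/RigidityForcesSymmetryRigidMinimalRepr{StubSliceOpen,StubPencilLocInj,InfRigidToLocallyOpen}.lean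
(`sliceOpen`, `hasFDerivAt_det_of_hasFDerivAt`, `eventually_eq_of_hasFDerivAt_of_ker_eq_bot`,
`exists_finset_forall_mem`, `infRigidToLocallyOpen_of_slice` as template).

Novelty: Searches (2026-08-15): zbMATH ×4 — "determinantal representation permanent symmetry" (2: LR17 + its
ITCS version), "equivariant
determinantal complexity" (7, only LR17 relevant), "permanent versus determinant symmetry" (1,
irrelevant), "Grenet permanent
determinant optimal" (2: LR17); `lit citing arxiv:1508.05788` (18 citers: Kumar–Volk 2022
arXiv:2009.02452, arXiv:2308.04599,
Dawar–Wilsenach 2020 arXiv:2002.06451, Bürgisser 2024 arXiv:2406.06217,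
doi:10.1007/s00224-025-10253-8, …) — none derives
symmetry from rigidity or states a torus-only bound; `lit frontier ValiantsHypothesis --since 2020`
(30 rows; dc items
arXiv:2606.11090, arXiv:2606.13628 are invariant-based); `lit bridges ValiantsHypothesis --cross
any` (surveys only); `lit read
arxiv:1508.05788` pp. 5–7, 14 (Q2.2 "we have no opinion"; Thm 2.8 needs N(T^GL(E)); "rigidity of
tori" appears only inside their
equivariant proof); OpenAlex / arXiv / S2 HTTP 429 and `lit galaxy search "determinantal
representation of the permanent" --star
all` 0 rows (pdf, crabby timed out) at filing — recorded, not worked around.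
Nearest prior art found: LandsbergRessayre2017 = arXiv:1508.05788 (Q2.2/Cor 2.3 pose symmetrisation
without mechanism; Thm 2.8
uses the Weyl group); HuttenhainIkenmeyer2016 = arXiv:1410.8202 §4 Prop 9 (binary uniqueness of
Grenet(3)); AlperBogartVelasco2017
(dc(per_3) = 7); in-tree siblings rigid-minimal-detreps-inherit-symmetry (finiteness + small-index
subgroups + S_n) and
grenet-stability-bootstrap (uniqueness  [refs: 10.1007/s00224-025-10253-8, 1508.05788, 2009.02452, 2308.04599, 2002.06451, 2406.06217, 2606.11090, 2606.13628, 1410.8202, arxiv:1508.05788, doi:10.1007/s00224-025-10253-8, LandsbergRessayre2017, HuttenhainIkenmeyer2016, AlperBogartVelasco2017]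

Barriers (technique_class: deformation-rigidity, torus-equivariance): - technique_class: deformation-rigidity, torus-equivariance
- Literature.Barriers.ValiantsHypothesis.PermanentCharTwo: everything is over ℂ; in characteristic 2
the size-n representation per = det is IRREGULAR (Λ = 0) and TorusBound's proof uses von zur Gathen
regularity (rank Λ = m − 1, n ≥ 3, char ≠ 2) — the chain breaks exactly there, consistently (and at
n = 2 over ℂ for the same reason).
- Literature.Barriers.ValiantsHypothesis.RankMethods: no tensor/Waring/flattening rank is certified;
the bound is a grading-support count valid only for torus-graded representations and is transferred
to general ones by rigidity, not by a sub-additive measure; RankLifting and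
ShiftedPartialsCannotSeparate likewise do not apply (no flattenings, no padding).
- Literature.Barriers.ValiantsHypothesis.MonotoneGap: the pigeonhole runs inside the graded model,
where cancellation cannot create support (a vertex of value (I,J) serves σ only if σ(I) = J,
whatever the signs and constants); the transfer to general representations is "rigid ⇒ graded", not
"monotone ⇒ general"; the barrier's VP witnesses with exponential monotone complexity are untouched
unless their minimal determinantal representations are rigid — a checkable prediction (they should
not be).
- Literature.Barriers.ValiantsHypothesis.AlgebraicNaturalProofs: rigidity of the solution variety of
the single polynomial per_n is not a distinguisher on coefficient space vanishing on all small
circuits; not engaged.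
- Literature.Barriers.Vali

History (route lifecycle, newest last):
- 2026-08-17T10:04:03Z · BROKEN — RigidMinimalRepr (stmt-ValiantsHypothesis-4163, crux) refuted by Summit.ValiantsHypothesis.ValiantsHypothesis.Theorems.RigidityForcesSymmetryRigidMinimalRepr.not_RigidMinimalRepr @ 08beaf943fff (prover-line-stmt-ValiantsHypothesis-4163-c1-0)
- 2026-08-17T10:35:52Z · BROKEN — RigidAtThree (stmt-ValiantsHypothesis-4165, crux) refuted by Summit.ValiantsHypothesis.ValiantsHypothesis.Theorems.RigidityForcesSymmetryRigidAtThree.not_RigidAtThree @ fc5d89dae105 (prover-line-stmt-ValiantsHypothesis-4163-c1-0)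
- 2026-08-17T10:50:25Z · rev 3: restated Assembly (stmt-ValiantsHypothesis-4168 proved) — repair rev 2b (clear BROKEN): drop the two REFUTED rev-1 items RigidMinimalRepr (stmt-4163, not_RigidMinimalRepr) and RigidAtThree (stmt-4165, not_RigidAtThree) (planner-rfix-ValiantsHypothesis-RigidityForc-9673f30f-0)
- 2026-08-17T10:50:25Z · rev 3: dropped RigidMinimalRepr, RigidAtThree — repair rev 2b (clear BROKEN): drop the two REFUTED rev-1 items RigidMinimalRepr (stmt-4163, not_RigidMinimalRepr) and RigidAtThree (stmt-4165, not_RigidAtThree) (planner-rfix-ValiantsHypothesis-RigidityForc-9673f30f-0)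
- 2026-08-17T10:50:25Z · REPAIRED (restate Assembly; drop RigidMinimalRepr, RigidAtThree) — back to open: repair rev 2b (clear BROKEN): drop the two REFUTED rev-1 items RigidMinimalRepr (stmt-4163, not_RigidMinimalRepr) and RigidAtThree (stmt-4165, not_RigidAtThree) (planner-rfix-ValiantsHypothesis-RigidityForc-9673f30f-0)
- 2026-08-28T10:15:56Z · BROKEN — LaplaceOptimalFourFive (stmt-ValiantsHypothesis-27319, support) refuted by Summit.ValiantsHypothesis.ValiantsHypothesis.Theorems.not_LaplaceOptimalFourFive (prover-val-lit-p8-g12-0)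
- 2026-08-28T10:17:29Z · rev 12: dropped LaplaceOptimalFourFive — repair (director g13 R203 (c)): LaplaceOptimalFourFive (stmt-ValiantsHypothesis-27319) refuted by Summit.ValiantsHypothesis.ValiantsHypothesis.Theorems.not_Lapl (planner-tenure-valiant-dormant-sweep-g12-0)
- 2026-08-28T10:17:29Z · REPAIRED (drop LaplaceOptimalFourFive) — back to open: repair (director g13 R203 (c)): LaplaceOptimalFourFive (stmt-ValiantsHypothesis-27319) refuted by Summit.ValiantsHypothesis.ValiantsHypothesis.Theorems.not_Lapl (planner-tenure-valiant-dormant-sweep-g12-0)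

sub-problem: ValiantsHypothesis · status: open · opened planner-plancard-ValiantsHypothesis-ValiantsH-a9785652-0 2026-08-15T11:28:47Z · rev 12 · ledger route-ValiantsHypothesis-RigidityForcesSymmetry
GENERATED by the gate from the ledger (D-0016/17). Provers cite these decls: `theorem foo : Summit.ValiantsHypothesis.ValiantsHypothesis.Theses.RigidityForcesSymmetry.<Decl> := …` in Summits/ValiantsHypothesis/ValiantsHypothesis/Theorems/<Name>.lean.
-/

namespace Summit.ValiantsHypothesis.ValiantsHypothesis.Theses.RigidityForcesSymmetry

open scoped BigOperators Topology Manifold Classical MeasureTheory ProbabilityTheory Matrix InnerProductSpace ComplexConjugate ContinuousMap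
open Filter Set Function TopologicalSpace MeasureTheory

attribute [summit_statement] _root_.ValiantsHypothesis

open Literature.PNP

/-! Retired items kept as plain definitions (history; not obligations of this route): landed proofs / closed glue still name them. -/

/-- retired stmt-ValiantsHypothesis-27319 (dropped, gen None) — refuted by Summit.ValiantsHypothesis.ValiantsHypothesis.Theorems.not_LaplaceOptimalFourFive. -/
def LaplaceOptimalFourFive : Prop :=
  ∀ (N : ℕ) (T : Finset (Fin N)) (S : Fin N → Finset (Fin 4)) (u w : Fin N → (Fin 4 → Fin 5) → ℂ), (∀ t, ∀ v v' : Fin 4 → Fin 5, (∀ k ∈ S t, v k = v' k) → u t v = u t v') → (∀ t, ∀ v v' : Fin 4 → Fin 5, (∀ k, k ∉ S t → v k = v' k) → w t v = w t v') → (∀ v : Fin 4 → Fin 5, (∑ t ∈ T, u t v * w t v) = if Function.Injective v then 1 else 0) → 10 ≤ ∑ t ∈ T, (if (S t).card = 2 then 1 else if (S t).card = 1 ∨ (S t).card = 3 then 2 else 10)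

/-- item stmt-ValiantsHypothesis-4162 · target · rank 0 · open · by planner
why it might fail: far stronger than VH: any O(c^n) construction with c < 2 for all large n kills it (Ryser/Glynn formulas are only a factor n away, O(n·2^n)); beyond dc(per_3) = 7 nothing is known, dc(per_4) ≤ 14 would be the first alarm.
sources: Grenet2011, AlperBogartVelasco2017, LandsbergRessayre2017, HuttenhainIkenmeyer2016, MignonRessayre2004
[target] Grenet's bound is attained infinitely often: for every n₀ there is n ≥ n₀ with 2^n − 1 ≤
dc(per_n) (so dc(per_n) = 2^n − 1 there, by `determinantalComplexity_perPoly_le`); expected for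
every n ≥ 3. -/
@[route_item "route-ValiantsHypothesis-RigidityForcesSymmetry", crux]
def GrenetLowerBound : Prop :=
  ∀ n₀ : ℕ, ∃ n ≥ n₀, 2 ^ n - 1 ≤ Literature.Computability.AlgebraicComplexity.determinantalComplexity (Literature.Computability.AlgebraicComplexity.perPoly (Fin n) ℂ)

/-- item stmt-ValiantsHypothesis-18034 · crux · rank 2 · open · by planner
why it might fail: Rank-PRESERVING affine unimodular gauge moves, or genuine equal-rank moduli, may exist at every tight torus-graded rep for n ≥ 4 (checked to first order at n = 3 only; Grenet(4) constrained tangent untested, unconstrained gap 204); FALSE if dc(per_n) < 2^n − 1 for all large n (TorusBound).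
sources: LandsbergRessayre2017, HuttenhainIkenmeyer2016, AlperBogartVelasco2017, IkenmeyerLandsberg2017, arXiv:2003.04834
[crux] repaired RigidMinimalRepr (stmt-4163, refuted by the Koszul row twist, which RAISES the rank
of a coefficient matrix — stub_rankJump): for infinitely many n there is an affine determinantal
representation Ã = Λ + Σ_v x_v A_v of per_n of MINIMAL size m = dc(per_n) whose GL_m×GL_m-orbit is
open INSIDE ITS RANK-PROFILE STRATUM of R_m(per_n): some neighbourhood U of (Λ, A) in coefficient
space meets {det = per_n} ∩ {∀ v, rank A′_v ≤ rank A_v} only inside {(gΛh⁻¹, (gA_vh⁻¹)_v)} (rank Λ′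
= m − 1 is automatic by von zur Gathen, proved in tree). Local, single-orbit, infinitely-often
shadow of RigidMinimalReps.DoublyMinimalFinite (stmt-5113 implies it); TRUE to first order at
Grenet(3) (rank-constrained Zariski tangent = gauge tangent = 96, sibling kit runs), where dc(per_3)
= 7 is a tree theorem; with the proved supports it reads as a dichotomy: dc(per_n) = 2^n − 1 or
every minimal representation of per_n is non-isolated in its own rank stratum. [difficulty:
open-problem] -/
@[route_item "route-ValiantsHypothesis-RigidityForcesSymmetry", crux]
def RankRigidMinimalRepr : Prop :=
  ∀ n₀ : ℕ, ∃ n ≥ n₀, ∃ (m : ℕ) (Λ : Matrix (Fin m) (Fin m) ℂ) (A : Fin n × Fin n → Matrix (Fin m) (Fin m) ℂ), m = Literature.Computability.AlgebraicComplexity.determinantalComplexity (Literature.Computability.AlgebraicComplexity.perPoly (Fin n) ℂ) ∧ (Λ.map MvPolynomial.C + ∑ v, (MvPolynomial.X v : MvPolynomial (Fin n × Fin n) ℂ) • (A v).map MvPolynomial.C).det = Literature.Computability.AlgebraicComplexity.perPoly (Fin n) ℂ ∧ ∃ U ∈ nhds (Λ, A), ∀ p ∈ U, (p.1.map MvPolynomial.C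 + ∑ v, (MvPolynomial.X v : MvPolynomial (Fin n × Fin n) ℂ) • (p.2 v).map MvPolynomial.C).det = Literature.Computability.AlgebraicComplexity.perPoly (Fin n) ℂ → (∀ v, (p.2 v).rank ≤ (A v).rank) → ∃ g h : GL (Fin m) ℂ, p.1 = (g : Matrix (Fin m) (Fin m) ℂ) * Λ * ((h⁻¹ : GL (Fin m) ℂ) : Matrix (Fin m) (Fin m) ℂ) ∧ ∀ v, p.2 v = (g : Matrix (Fin m) (Fin m) ℂ) * A v * ((h⁻¹ : GL (Fin m) ℂ) : Matrix (Fin m) (Fin m) ℂ)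

/-- item stmt-ValiantsHypothesis-4164 · crux · rank 3 · closed · proved by Summit.ValiantsHypothesis.ValiantsHypothesis.Theorems.BorderApolarityToricWitnessObstructionQP.stub_torusBound @ 02c82ba038d1 (prover) · by planner
why it might fail: only our paper sketch exists (regularity → one generic torus element → eigenspace grading → Hamiltonian cycles only → unique factorisation → pigeonhole); LR17 needed S_m at the analogous step; a non-semisimple lift spoiling the grading, or a torus-equivariant rep of per_4 of size ≤ 14, kills it.
sources: LandsbergRessayre2017, Vonzurgathen1987, Grenet2011, MarcusMinc1961
[crux] (card item "TorusBound", two-sided version checked on paper by refuter-triage-7 and this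
planner) for n ≥ 3 every affine determinantal representation of per_n over ℂ that is equivariant
with exact lifts (`IsEquivariantDetRepr`) for the two-sided torus x ↦ D₁ x D₂ (diagonal
substitutions x_kl ↦ d_k e_l x_kl) has size ≥ 2^n − 1; tight (Grenet's representation is
two-sided-torus-equivariant of size 2^n − 1); LR17 Thm 2.8 minus the Weyl group, plus the right
torus. [difficulty: L] -/
@[route_item "route-ValiantsHypothesis-RigidityForcesSymmetry", crux]
def TorusBound : Prop :=
  ∀ n : ℕ, 3 ≤ n → ∀ (m : ℕ) (A : Matrix (Fin m) (Fin m) (MvPolynomial (Fin n × Fin n) ℂ)), Literature.Computability.AlgebraicComplexity.IsEquivariantDetRepr (Subgroup.closure {γ : GL (Fin n × Fin n) ℂ | ∃ d e : Fin n → ℂ, (γ : Matrix (Fin n × Fin n) (Fin n × Fin n) ℂ) = Matrix.diagonal (fun p => d p.1 * e p.2)}) (Literature.Computability.AlgebraicComplexity.perPoly (Fin n) ℂ) A → 2 ^ n - 1 ≤ m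

-- `TorusBound` holds: proved by `Summit.ValiantsHypothesis.ValiantsHypothesis.Theorems.BorderApolarityToricWitnessObstructionQP.stub_torusBound` @ 02c82ba038d1 (its module imports this route file, so no `_holds` link can be stated here).

/-- item stmt-ValiantsHypothesis-18035 · support · rank 9 · closed · proved by Summit.ValiantsHypothesis.ValiantsHypothesis.Theorems.rankRigidityForcesTorus_proof @ f281c5892fcb (prover) · by planner
sources: LandsbergRessayre2017, Borel1991
[support] rank-stratum rigidity forces the torus: if Ã = Λ + Σ_v x_v A_v represents per_n (n ≥ 3)
and its GL_m×GL_m-orbit is open near (Λ, A) among the representations p with det p̃ = per_n and rank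
(p.2 v) ≤ rank (A v) for all v (the hypothesis of RankRigidMinimalRepr, same sub-expressions), then
Ã is two-sided-torus-equivariant with exact lifts (IsEquivariantDetRepr for the closure of {diag(d_k
e_l)}). Proof = Theorems/RigidityForcesSymmetryRigidityForcesTorus.lean `rigidityForcesTorus_proof`
verbatim: its coefficient path F(a,b) = (D Λ, v ↦ exp(a_k+b_l)·D A_v), D = diag(τ,1,…,1), has det =
per_n AND the same cellwise ranks as (Λ, A) (D invertible, scalar ≠ 0:
Matrix.rank_mul_eq_right_of_isUnit_det + rank of a unit smul), so the constrained rigidity applies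
along it; liftable parameters form an additive subgroup of ℂ^2n containing a ball, hence all;
closure induction. [difficulty: provable-now] -/
@[route_item "route-ValiantsHypothesis-RigidityForcesSymmetry", crux]
def RankRigidityForcesTorus : Prop :=
  ∀ n : ℕ, 3 ≤ n → ∀ (m : ℕ) (Λ : Matrix (Fin m) (Fin m) ℂ) (A : Fin n × Fin n → Matrix (Fin m) (Fin m) ℂ), (Λ.map MvPolynomial.C + ∑ v, (MvPolynomial.X v : MvPolynomial (Fin n × Fin n) ℂ) • (A v).map MvPolynomial.C).det = Literature.Computability.AlgebraicComplexity.perPoly (Fin n) ℂ → (∃ U ∈ nhds (Λ, A), ∀ p ∈ U, (p.1.map MvPolynomial.C + ∑ v, (MvPolynomial.X v : MvPolynomial (Fin n × Fin n) ℂ) • (p.2 v).map MvPolynomial.C).det = Literature.Computability.AlgebraicComplexity.perPoly (Fin n) ℂ → (∀ v, (p.2 v).rank ≤ (A v).rank) → ∃ g h : GL (Fin m) ℂ, p.1 = (g : Matrix (Fin m) (Fin m) ℂ) * Λ * ((h⁻¹ : GL (Fin m) ℂ) : Matrix (Fin m) (Fin m) ℂ) ∧ ∀ v, p.2 v = (g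 : Matrix (Fin m) (Fin m) ℂ) * A v * ((h⁻¹ : GL (Fin m) ℂ) : Matrix (Fin m) (Fin m) ℂ)) → Literature.Computability.AlgebraicComplexity.IsEquivariantDetRepr (Subgroup.closure {γ : GL (Fin n × Fin n) ℂ | ∃ d e : Fin n → ℂ, (γ : Matrix (Fin n × Fin n) (Fin n × Fin n) ℂ) = Matrix.diagonal (fun p => d p.1 * e p.2)}) (Literature.Computability.AlgebraicComplexity.perPoly (Fin n) ℂ) (Λ.map MvPolynomial.C + ∑ v, (MvPolynomial.X v : MvPolynomial (Fin n × Fin n) ℂ) • (A v).map MvPolynomial.C)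

-- `RankRigidityForcesTorus` holds: proved by `Summit.ValiantsHypothesis.ValiantsHypothesis.Theorems.rankRigidityForcesTorus_proof` @ f281c5892fcb (its module imports this route file, so no `_holds` link can be stated here).

/-- item stmt-ValiantsHypothesis-21029 · support · rank 9 · closed · proved by Summit.ValiantsHypothesis.Theorems.RigidityForcesSymmetry.GrenetGauge.GrenetFirstOrderRankRigid_proof (prover) · by planner
[support] T2 rung of RankRigidMinimalRepr (stmt-18034; tenure sweep TABLE row 36, director-valiant
g8 16:23:56Z) — GRENET FIRST-ORDER RANK RIGIDITY for all n ≥ 3 (= the crux-strategist's sub-crux A1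
`TightRankInfRigid`, Cruxes/RankRigidMinimalRepr/CruxCalibration.lean, stated existentially so no
`grenetRepr` definition is needed; the witness is Grenet's size-(2ⁿ−1) representation): some
size-(2ⁿ−1) affine determinantal representation (Λ, A) of per_n is rank-infinitesimally rigid —
every direction (Λ', A') that is Zariski-tangent to {det = per_n} (tr(adj x̃ · x̃') = 0, Jacobi) and
tangent to the rank stratum (A'_v ker A_v ⊆ im A_v) is a gauge direction (PΛ − ΛQ, (PA_v − A_vQ)_v).
Provable-grade combinatorics of the Grenet graph; certified numerically for n = 3..8 (kit j025573:
constrained tangent = gauge tangent = 2m² − 2, exact mod two primes). With the slice lemma A2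
(RankInfRigidToLocallyOpen) it gives TightRankRigid, and `crux_iff_target : TightRankRigid →
RankRigidityForcesTorus → (RankRigidMinimalRepr ↔ GrenetLowerBound)` is kernel-checked there. Why it
might fail: a non-gauge rank-preserving first-order deformation of Grenet(n) at some n ≥ 9 (none for
n ≤ 8); difficulty M/L. -/
@[route_item "route-ValiantsHypothesis-RigidityForcesSymmetry"]
def GrenetFirstOrderRankRigid : Prop :=
  ∀ n : ℕ, 3 ≤ n → ∃ (Λ : Matrix (Fin (2 ^ n - 1)) (Fin (2 ^ n - 1)) ℂ) (A : Fin n × Fin n → Matrix (Fin (2 ^ n - 1)) (Fin (2 ^ n - 1)) ℂ), (Λ.map MvPolynomial.C + ∑ v, (MvPolynomial.X v : MvPolynomial (Fin n × Fin n) ℂ) • (A v).map MvPolynomial.C).det = Literature.Computability.AlgebraicComplexity.perPoly (Fin n) ℂ ∧ ∀ (Λ' : Matrix (Fin (2 ^ n - 1)) (Fin (2 ^ n - 1)) ℂ) (A' : Fin n × Fin n → Matrix (Fin (2 ^ n - 1)) (Fin (2 ^ n - 1)) ℂ), ((Λ.map MvPolynomial.C + ∑ v, (MvPolynomial.X v :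 MvPolynomial (Fin n × Fin n) ℂ) • (A v).map MvPolynomial.C).adjugate * (Λ'.map MvPolynomial.C + ∑ v, (MvPolynomial.X v : MvPolynomial (Fin n × Fin n) ℂ) • (A' v).map MvPolynomial.C)).trace = (0 : MvPolynomial (Fin n × Fin n) ℂ) → (∀ v w, (A v).mulVec w = 0 → ∃ u, (A' v).mulVec w = (A v).mulVec u) → ∃ P Q : Matrix (Fin (2 ^ n - 1)) (Fin (2 ^ n - 1)) ℂ, Λ' = P * Λ - Λ * Q ∧ ∀ v, A' v = P * A v - A v * Q

-- `GrenetFirstOrderRankRigid` holds: proved by `Summit.ValiantsHypothesis.Theorems.RigidityForcesSymmetry.GrenetGauge.GrenetFirstOrderRankRigid_proof` (its module imports this route file, so no `_holds` link can be stated here).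

/-- item stmt-ValiantsHypothesis-24282 · support · rank 9 · closed · proved by Summit.ValiantsHypothesis.ValiantsHypothesis.Theorems.RigidityForcesSymmetry.RankSlice.RankInfRigidToLocallyOpen_proof (prover) · by planner
[support] Sub-crux A2 of crux RankRigidMinimalRepr (stmt-18034) — the RANK-CONSTRAINED SLICE LEMMA
(crux-strategist's Cruxes/RankRigidMinimalRepr/CruxCalibration.lean,
`Census.RankInfRigidToLocallyOpen`, verbatim): for an affine pencil x̃₀ = Λ + Σ_v x_v A_v with det
x̃₀ = f ≠ 0, if every first-order direction (Λ', A') that is tangent to the det-fibre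
(tr(adj(x̃₀)·x̃') = 0) AND rank-tangent at each slice (A'_v · ker A_v ⊆ im A_v) is an infinitesimal
gauge motion (Λ', A') = (PΛ − ΛQ, PA_v − A_vQ), then on a neighbourhood of (Λ, A) every pencil with
det = f and rank A'_v ≤ rank A_v for all v is gauge-equivalent g·x̃₀·h⁻¹. Folklore (infinitesimal
rigidity ⇒ local rigidity / open orbit in the constrained stratum: Asimow–Roth shape,
Fuhrmann–Helmke 2015 Lemma 8.30 & p.407; Luna/orbit–slice chart); the UNCONSTRAINED version is
already a tree theorem (`stub_infRigidToLocallyOpen`, via `infRigidToLocallyOpen_of_slice` +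
`sliceOpen` + `eventually_eq_of_hasFDerivAt_of_ker_eq_bot`); the new ingredient is the
Schur-complement chart of {rank ≤ r} near a rank-r matrix (a submanifold whose tangent at A_v is {A'
: A'·ker A_v ⊆ im A_v}). ROLE: with A1 = GrenetFirstOrderRankRigid (stmt-21029, PROVED -/
@[route_item "route-ValiantsHypothesis-RigidityForcesSymmetry"]
def RankInfRigidToLocallyOpen : Prop :=
  ∀ (ι : Type) [Fintype ι] (m : ℕ) (f : MvPolynomial ι ℂ) (Λ : Matrix (Fin m) (Fin m) ℂ) (A : ι → Matrix (Fin m) (Fin m) ℂ), f ≠ 0 → (Λ.map MvPolynomial.C + ∑ v, (MvPolynomial.X v : MvPolynomial ι ℂ) • (A v).map MvPolynomial.C).det = f → (∀ (Λ' : Matrix (Fin m) (Fin m) ℂ) (A' : ι → Matrix (Fin m) (Fin m) ℂ), ((Λ.map MvPolynomial.C + ∑ v, (MvPolynomial.X v : MvPolynomial ι ℂ) • (A v).map MvPolynomial.C).adjugate * (Λ'.map MvPolynomial.C + ∑ v, (MvPolynomial.X v : MvPolynomial ι ℂ) • (A' v).map MvPolynomial.C)).trace = (0 : MvPolynomial ι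 ℂ) → (∀ v w, (A v).mulVec w = 0 → ∃ u, (A' v).mulVec w = (A v).mulVec u) → ∃ P Q : Matrix (Fin m) (Fin m) ℂ, Λ' = P * Λ - Λ * Q ∧ ∀ v, A' v = P * A v - A v * Q) → ∃ U ∈ nhds (Λ, A), ∀ p ∈ U, (p.1.map MvPolynomial.C + ∑ v, (MvPolynomial.X v : MvPolynomial ι ℂ) • (p.2 v).map MvPolynomial.C).det = f → (∀ v, (p.2 v).rank ≤ (A v).rank) → ∃ g h : GL (Fin m) ℂ, p.1 = (g : Matrix (Fin m) (Fin m) ℂ) * Λ * ((h⁻¹ : GL (Fin m) ℂ) : Matrix (Fin m) (Fin m) ℂ) ∧ ∀ v, p.2 v = (g : Matrix (Fin m) (Fin m) ℂ) * A v * ((h⁻¹ : GL (Fin m) ℂ) : Matrix (Fin m) (Fin m) ℂ)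

-- `RankInfRigidToLocallyOpen` holds: proved by `Summit.ValiantsHypothesis.ValiantsHypothesis.Theorems.RigidityForcesSymmetry.RankSlice.RankInfRigidToLocallyOpen_proof` (its module imports this route file, so no `_holds` link can be stated here).

/-- item stmt-ValiantsHypothesis-24813 · support · rank 9 · open · by planner
[support · FRONTIER RUNG n = 5 of the tied-torus ladder on crux RankRigidMinimalRepr (stmt-18034);
bankable, 0 width until a seat asks — director-valiant g10 RULING D11.2 + 2026-08-28T02:19:23Z]
LAPLACE EXPANSION IS OPTIMAL FOR THE 5 × 5 PERMUTATION PATTERN: every split-rank-one decomposition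
P₅(v) = Σ_t u_t(v|_{S_t})·w_t(v|_{S_tᶜ}) of the pattern [v injective] on Fin 5 → Fin 5 has Σ_t
|S_t|!·(5 − |S_t|)! ≥ 5! = 120 (weighted partition-rank bound; tight for Laplace expansion along any
r-set). DEFINITIONALLY
`Summit.ValiantsHypothesis.ValiantsHypothesis.Theorems.RigidityForcesSymmetryRankRigidMinimalRepr.LaplaceOptimal
5` (Theorems/RigidityForcesSymmetryRankRigidMinimalReprLaplaceDefs.lean; `Iff.rfl` checked in tenure
sketch rfs/Sketch_rungs.lean, lean rc 0) — inlined because the route file cannot import Theorems/.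
Ladder state: `laplaceOptimal_one/two/three` (…LaplaceOptimalSmall), `laplaceOptimal_four` (p597028
…LaplaceFourOptimal, val-lit p8 g9, 19 maximal cheap profiles refuted over 27 helper files) ⇒ rungs
TiedTorusBound 1, 2, 3 landed; this item is the single finite input for TiedTorusBound 4 (companion
item TiedTorusBoundFour, kernel transfer `grenetBound_of_laplaceOptimal (k -/
@[route_item "route-ValiantsHypothesis-RigidityForcesSymmetry", crux (bottleneck := work) (experiment := "instrument: Products/KPTT** (5906): `ConeTopBound` **ATTACKABLE** (LV chain in kernel; lead+hands exist) — summit edge `NewtonPolygonTauTransfer` gener…") (source := "director HOURLY-Valiant l.1576, 2026-09-01")]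
def LaplaceOptimalFive : Prop :=
  ∀ (N : ℕ) (T : Finset (Fin N)) (S : Fin N → Finset (Fin 5)) (u w : Fin N → (Fin 5 → Fin 5) → ℂ), (∀ t, ∀ v v' : Fin 5 → Fin 5, (∀ i ∈ S t, v i = v' i) → u t v = u t v') → (∀ t, ∀ v v' : Fin 5 → Fin 5, (∀ i, i ∉ S t → v i = v' i) → w t v = w t v') → (∀ v : Fin 5 → Fin 5, (∑ t ∈ T, u t v * w t v) = if Function.Injective v then 1 else 0) → Nat.factorial 5 ≤ ∑ t ∈ T, (S t).card.factorial * (5 - (S t).card).factorial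

/-- item stmt-ValiantsHypothesis-24814 · support · rank 9 · open · by planner
[support · FRONTIER RUNG k = 4 of the tied-torus ladder on crux RankRigidMinimalRepr (stmt-18034);
bankable, 0 width until a seat asks — director-valiant g10 RULING D11.2 + 2026-08-28T02:19:23Z]
GRENET IS OPTIMAL UNDER THE TORUS WITH FIVE COLUMN SCALARS TIED: for every m ≥ 3, every affine
determinantal representation A of per_m (size n) that is equivariant (exact lifts,
`IsEquivariantDetRepr`) under the two-sided torus x_{kj} ↦ d_k e_j x_{kj} with e_0 = … = e_4 tied
has n ≥ 2^m − 1. DEFINITIONALLY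
`Summit.ValiantsHypothesis.ValiantsHypothesis.Theorems.RigidityForcesSymmetryPairTiedTorusBound.TiedTorusBound
4` (Theorems/RigidityForcesSymmetryRankRigidMinimalReprTiedTorusDefs.lean; `Iff.rfl` checked in
tenure sketch rfs/Sketch_rungs.lean, rc 0) — inlined (route file cannot import Theorems/); same
shape as the proved floor `TorusBound` (k = 0, stmt-4164) with the tie added. Ladder: k = 1, 2
(…TiedTorusBoundOneTwo), k = 3 (`tiedTorusBound_three`, p597028 via `laplaceOptimal_four`).
REDUCTION PROVED IN KERNEL (sketch, 0 sorry): companion item LaplaceOptimalFive → this item, by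
`grenetBound_of_laplaceOptimal (k := 4)` for m ≥ 5 and `tiedTorusBound_three` +
`IsEquivariantDetRepr.anti` (cl -/
@[route_item "route-ValiantsHypothesis-RigidityForcesSymmetry"]
def TiedTorusBoundFour : Prop :=
  ∀ m : ℕ, 3 ≤ m → ∀ (n : ℕ) (A : Matrix (Fin n) (Fin n) (MvPolynomial (Fin m × Fin m) ℂ)), Literature.Computability.AlgebraicComplexity.IsEquivariantDetRepr (Subgroup.closure {γ : GL (Fin m × Fin m) ℂ | ∃ d e : Fin m → ℂ, (∀ j j' : Fin m, j.val ≤ 4 → j'.val ≤ 4 → e j = e j') ∧ (γ : Matrix (Fin m × Fin m) (Fin m × Fin m) ℂ) = Matrix.diagonal (fun p => d p.1 * e p.2)}) (Literature.Computability.AlgebraicComplexity.perPoly (Fin m) ℂ) A → 2 ^ m - 1 ≤ n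

/-- item stmt-ValiantsHypothesis-4166 · support · rank 9 · closed · proved by Summit.ValiantsHypothesis.ValiantsHypothesis.Theorems.rigidityForcesTorus_proof @ 0865e2a5bbee (prover) · by planner
sources: LandsbergRessayre2017, Borel1991
[support] (card item "isolated orbit ⇒ respects H°") if Ã = Λ + Σ_v x_v A_v represents per_n (n ≥ 3)
and its GL_m×GL_m-orbit is locally open in R_m(per_n) in the sense of RigidMinimalRepr, then Ã is
two-sided-torus-equivariant with exact lifts: t ↦ diag(1/c_t,1,…,1)·Ã(t⁻¹x) is a continuous path in
R_m(per_n) through Ã, so lifts exist for t near 1; lifts compose and invert (linSubst_mul), and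
pulling back along exp : ℂ^2n → torus the set of liftable parameters is an additive subgroup
containing a ball, hence everything; closure induction finishes. [difficulty: provable-now] -/
@[route_item "route-ValiantsHypothesis-RigidityForcesSymmetry"]
def RigidityForcesTorus : Prop :=
  ∀ n : ℕ, 3 ≤ n → ∀ (m : ℕ) (Λ : Matrix (Fin m) (Fin m) ℂ) (A : Fin n × Fin n → Matrix (Fin m) (Fin m) ℂ), (Λ.map MvPolynomial.C + ∑ v, (MvPolynomial.X v : MvPolynomial (Fin n × Fin n) ℂ) • (A v).map MvPolynomial.C).det = Literature.Computability.AlgebraicComplexity.perPoly (Fin n) ℂ → (∃ U ∈ nhds (Λ, A), ∀ p ∈ U, (p.1.map MvPolynomial.C + ∑ v, (MvPolynomial.X v : MvPolynomial (Fin n × Fin n) ℂ) • (p.2 v).map MvPolynomial.C).det = Literature.Computability.AlgebraicComplexity.perPoly (Fin n) ℂ → ∃ g h : GL (Fin m) ℂ, p.1 = (g : Matrix (Fin m) (Fin m) ℂ) * Λ * ((h⁻¹ : GL (Fin m) ℂ) : Matrix (Fin m) (Fin m) ℂ) ∧ ∀ v, p.2 v = (g : Matrix (Fin m) (Fin m)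 ℂ) * A v * ((h⁻¹ : GL (Fin m) ℂ) : Matrix (Fin m) (Fin m) ℂ)) → Literature.Computability.AlgebraicComplexity.IsEquivariantDetRepr (Subgroup.closure {γ : GL (Fin n × Fin n) ℂ | ∃ d e : Fin n → ℂ, (γ : Matrix (Fin n × Fin n) (Fin n × Fin n) ℂ) = Matrix.diagonal (fun p => d p.1 * e p.2)}) (Literature.Computability.AlgebraicComplexity.perPoly (Fin n) ℂ) (Λ.map MvPolynomial.C + ∑ v, (MvPolynomial.X v : MvPolynomial (Fin n × Fin n) ℂ) • (A v).map MvPolynomial.C)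

-- `RigidityForcesTorus` holds: proved by `Summit.ValiantsHypothesis.ValiantsHypothesis.Theorems.rigidityForcesTorus_proof` @ 0865e2a5bbee (its module imports this route file, so no `_holds` link can be stated here).

/-- item stmt-ValiantsHypothesis-4167 · support · rank 9 · closed · proved by Summit.ValiantsHypothesis.ValiantsHypothesis.Theorems.RigidityForcesSymmetryGrenetBoundToVH.GrenetBoundToVH_proof @ fe3497deb60e (prover) · by planner
sources: BurgisserClausenShokrollahi1997, Burgisser2000, Valiant1979
[support] GrenetLowerBound → ValiantsHypothesis: if VP = VNP then per ∈ VP (perFamily_mem_VNP_holds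
+ mem_VP_ofFintype_iff_holds), so dc(per_n) ≤ 2^((log₂ n + c)^c) for all n
(isQPBounded_determinantalComplexity_of_isVPFamily_holds, BCS97 Cor 21.40), contradicting 2^n − 1 ≤
dc(per_n) for some n with (log₂ n + c)^c < n; conclude with the hub
`Summit.ValiantsHypothesis.Hub.valiantsHypothesis_of_not_isVPFamily_per`. [difficulty: provable-now] -/
@[route_item "route-ValiantsHypothesis-RigidityForcesSymmetry", crux]
def GrenetBoundToVH : Prop :=
  GrenetLowerBound → ValiantsHypothesis

-- `GrenetBoundToVH` holds: proved by `Summit.ValiantsHypothesis.ValiantsHypothesis.Theorems.RigidityForcesSymmetryGrenetBoundToVH.GrenetBoundToVH_proof` @ fe3497deb60e (its module imports this route file, so no `_holds` link can be stated here).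

-- earlier Assembly (stmt-ValiantsHypothesis-4168, replaced 2026-08-17T10:50:25Z -> stmt-ValiantsHypothesis-18036): proved by Summit.ValiantsHypothesis.Theorems.RigidityForcesSymmetry.Assembly_proof @ f77b79f0dbc0 — RigidMinimalRepr → RigidityForcesTorus → TorusBound → GrenetBoundToVH → ValiantsHypothesis
/-- item stmt-ValiantsHypothesis-18036 · assembly · rank 1 · closed · proved by Summit.ValiantsHypothesis.Theorems.RigidityForcesSymmetry.Assembly_proof (prover) · by planner
sources: LandsbergRessayre2017, Grenet2011, BurgisserClausenShokrollahi1997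
[assembly] rev 2: RankRigidMinimalRepr → RankRigidityForcesTorus → TorusBound → GrenetBoundToVH →
ValiantsHypothesis (pure logic; identical to the deciding theorem `closes`, proved sorry-free in the
planner Sketch.lean: apply RankRigidMinimalRepr at max n₀ 3, RankRigidityForcesTorus gives exact
two-sided-torus lifts, TorusBound gives 2^n − 1 ≤ m = dc(per_n), GrenetBoundToVH concludes).
[difficulty: provable-now] -/
@[route_item "route-ValiantsHypothesis-RigidityForcesSymmetry"]
def Assembly : Prop :=
  RankRigidMinimalRepr → RankRigidityForcesTorus → TorusBound → GrenetBoundToVH → ValiantsHypothesis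

-- `Assembly` holds: proved by `Summit.ValiantsHypothesis.Theorems.RigidityForcesSymmetry.Assembly_proof` (its module imports this route file, so no `_holds` link can be stated here).

-- records of items no longer active in this route (dropped / restated):
-- earlier LaplaceOptimalFourFive (stmt-ValiantsHypothesis-27319, dropped 2026-08-28T10:17:29Z): refuted by Summit.ValiantsHypothesis.ValiantsHypothesis.Theorems.not_LaplaceOptimalFourFive — ∀ (N : ℕ) (T : Finset (Fin N)) (S : Fin N → Finset (Fin 4)) (u w : Fin N → (Fin 4 → Fin 5) → ℂ), (∀ t, ∀ v v' : Fin 4 → Fin 5, (∀ k ∈ S t, v k = v' k) → u t v = u t v') → (∀ t, ∀ v v' : Fin 4 → Fin 5, (∀ k, k ∉ S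
-- earlier RigidMinimalRepr (stmt-ValiantsHypothesis-4163, dropped 2026-08-17T10:50:25Z): refuted by Summit.ValiantsHypothesis.ValiantsHypothesis.Theorems.RigidityForcesSymmetryRigidMinimalRepr.not_RigidMinimalRepr @ 0a862bcd0665 — ∀ n₀ : ℕ, ∃ n ≥ n₀, ∃ (m : ℕ) (Λ : Matrix (Fin m) (Fin m) ℂ) (A : Fin n × Fin n → Matrix (Fin m) (Fin m) ℂ), m = Literature.Computability.AlgebraicComplexity.determinantal
-- earlier RigidAtThree (stmt-ValiantsHypothesis-4165, dropped 2026-08-17T10:50:25Z): refuted by Summit.ValiantsHypothesis.ValiantsHypothesis.Theorems.RigidityForcesSymmetryRigidAtThree.not_RigidAtThree @ e2ab97b82c52 — ∃ (Λ : Matrix (Fin 7) (Fin 7) ℂ) (A : Fin 3 × Fin 3 → Matrix (Fin 7) (Fin 7) ℂ), (Λ.map MvPolynomial.C + ∑ v, (MvPolynomial.X v : MvPolynomial (Fin 3 × Fin 3) ℂ) • (A v).map MvPolynom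

/-! D-0027 §2.1 — DECIDING THEOREM (planner-authored via `route open/edit --closes-file`; by planner-rfix-ValiantsHypothesis-RigidityForc-9673f30f-0 2026-08-17T10:45:32Z):
its hypotheses are this route's items and its conclusion the sub-problem Statement (glue_lint), and it elaborates with this file. -/

@[closes "route-ValiantsHypothesis-RigidityForcesSymmetry"] theorem closes (h_RankRigidMinimalRepr : RankRigidMinimalRepr)
    (h_RankRigidityForcesTorus : RankRigidityForcesTorus) (h_TorusBound : TorusBound)
    (h_GrenetBoundToVH : GrenetBoundToVH) : _root_.ValiantsHypothesis := by
  refine h_GrenetBoundToVH ?_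
  intro n₀
  obtain ⟨n, hn, m, Λ, A, hm, hdet, hU⟩ := h_RankRigidMinimalRepr (max n₀ 3)
  have h₃ : 3 ≤ n := le_trans (le_max_right n₀ 3) hn
  refine ⟨n, le_trans (le_max_left n₀ 3) hn, ?_⟩
  have hb := h_TorusBound n h₃ m _ (h_RankRigidityForcesTorus n h₃ m Λ A hdet hU)
  rw [hm] at hb
  exact hb

end Summit.ValiantsHypothesis.ValiantsHypothesis.Theses.RigidityForcesSymmetry
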